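import Literature.NumberTheory.LFunctions.ChebyshevHalfLineBiasThm1Proofs
import Literature.NumberTheory.LFunctions.HalfLinePrimeSumLandau
import Literature.NumberTheory.LFunctions.NicolasJExplicit
import Literature.NumberTheory.LFunctions.ExplicitFormulaPsiProofs
import Literature.NumberTheory.LFunctions.CramerMeanSquareRH
import Mathlib.NumberTheory.AbelSummation
import HarnessLib

/-!
# Suzuki 2025, Thm 2 (second assertion) and Thm 5 (second assertion): the `xe²` cut-off limit
# versus `RH ∧ Σ_ρ x^ρ/ρ = o(√x log x)` — discharges of `Suzuki2025Chebyshev_thm2_iff` and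
# `Suzuki2025Chebyshev_thm5_converse` («nothing here bears on the truth of RH»)

LINE 1 — LABEL: RH-FREE literature proofs of two RH-CONDITIONAL / RH-EQUIVALENT clauses
(M. Suzuki, *On variants of Chebyshev's conjecture*, Ramanujan J. **68** (2025) 95 = arXiv:2411.07436
[`Suzuki2025Chebyshev`], §1.1 Thm 2 (second assertion) and §1.2 Thm 5 (second assertion), AS PRINTED
and as typed in `ChebyshevHalfLineBiasVariants.lean`). bears_on: LADDER-RH COLUMN 1 SCREW (S-C,
criterion rung; the object is the tree's `zetaScrew = Ψ`). WHAT THIS IS NOT: an equivalence fixes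
WHICH limit statement is `RH ∧ (1.12)`; it is not worded as, and is not, progress toward RH;
nothing here bears on the truth of RH. Theorems only (no definitions, no named facts; D-0014/D-0026).

## The printed proofs (§3.2, §4.3) and this formalisation (a road through the tree — said once, here)

The paper derives both assertions from the second-order explicit formula (3.8) = [So09] for
`Σ_{n ≤ x} Λ(n) n^{-1/2} log(x/(ne²))`, whose zero sums are `2Σ_ρ x^{ρ−½}/(ρ−½)` and
`Σ_ρ x^{ρ−½}/(ρ−½)²`. The tree does not have (3.8); it has instead

* the screw-function identity `Σ_{n ≤ y} Λ(n) n^{-1/2} log(y/n) − 4√y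
  = 4/√y − 8 − Ψ(log y) − (κ/2) log y + ¼(C − y^{-1/2}Φ)` ([Suzuki2025Chebyshev] (1.7), (1.9):
  `zetaScrewNonArch_log`, `zetaScrew_eq_zetaScrewNonArch_sub_add`) and Suzuki 2023 Thm 1.6
  `RH ⟹ Ψ = O(1)` (`ZetaScrewGrowth.riemannHypothesis_iff_zetaScrew_bounded`);
* the absolutely convergent explicit formula for `ψ₁` (`psiOne_eq_explicit`, MV (13.7)) with its
  RH bounds (`NicolasJExplicit.exists_abs_Rone_le_of_RH`, `NicolasJExplicit.norm_zeroTerm_le`);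
* Montgomery–Vaughan's truncated explicit formula for `ψ₀` (Thm 12.5, `truncatedExplicitFormula_psi_holds`),
  whose zero sum IS the tree's `zetaZeroSumTrunc x T = Σ_{|γ| ≤ T} m(ρ) x^ρ/ρ` of condition (1.12).

With `y = xe²`, `Π(y) = Σ_{n ≤ y} Λ(n) n^{-1/2}` and `D(y) = 4√y − 2Π(y)` the first identity gives
`(F(x) + κ/2)·log x = D(y) − Ψ(log y) + O(1)` for the cut-off Riesz mean `F` of (1.11) (§4 below).
Abel summation and one integration by parts give
`Π(y) = ψ(y)/√y + ½ψ₁(y)y^{-3/2} + (3/4)∫₁ʸ ψ₁(t)t^{-5/2} dt` (§1); inserting the `ψ₁` formula and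
integrating the zero sum TERMWISE (`∫₁ʸ t^{ρ−3/2} dt = (y^{ρ−½} − 1)/(ρ − ½)`, bounded under RH by
the gap `|Im ρ| ≥ 2δ` of `ZetaZeroSum.exists_gap_im`) yields, under RH, `Π(y) = ψ(y)/√y + √y + O(1)`,
i.e. `D(y) = 2(y − ψ(y))/√y + O(1)` (§2–§3); MV Thm 12.5 at the single point `y` (`T → ∞`, `⟨y⟩ > 0`)
then gives `D(y) = 2 Re Σ_{|γ|≤T} y^ρ/ρ /√y + O(1)` and `Im Σ_{|γ|≤T} y^ρ/ρ → 0` eventually in `T`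
(§3; `ψ₀` versus `ψ` costs `(log y)/2`, the tree's `CramerMeanSquare.abs_psi_sub_chebyshevPsi₀_le`).
Hence under RH, (1.11) ⟺ `D(y) = o(log y)` ⟺ (1.12) (§5); and (1.11) ⟹ RH by Landau's
theorem in the tree's form `HalfLinePrimeSumLandau.riemannHypothesis_of_laplace_eq_mul` applied to
`2Π − φ + Bt ≥ 0` (§4; (1.11) bounds `φ(t) − 2Π(t) ≤ B(t − 2)`). Thm 5's second assertion follows:
the prime squares and higher powers beyond `x` contribute `≥ −2(ψ(xe²) − ϑ(xe²))/√x ≥ −O(1)`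
(Mathlib `Chebyshev.psi_sub_theta_le_mul_sqrt`), so the prime sum is
`≤ √x(−(κ/2) log x + o(log x) + O(1)) → −∞` (§6).

## References
* [Suzuki2025Chebyshev] M. Suzuki, Ramanujan J. 68 (2025) 95 = arXiv:2411.07436: Thm 2, Thm 5, (1.7),
  (1.9), (1.11), (1.12), (1.20), §3.2, §4.3.
* [Suzuki2023] M. Suzuki, J. Lond. Math. Soc. (2) 108 (2023) 1448–1487: Thm 1.6 (the tree).
* [MontgomeryVaughan2007] H. L. Montgomery, R. C. Vaughan, *Multiplicative Number Theory I*, CUP 2007: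
  Thm 12.5, (13.7) (the tree).
-/

noncomputable section

open Filter Topology Asymptotics MeasureTheory Set Complex
open scoped Real ArithmeticFunction.vonMangoldt Chebyshev

namespace Literature.NumberTheory.LFunctions

namespace ChebyshevHalfLineBiasThm2

open NicolasJ NicolasJExplicit

/-! ### §1 `Π(y) = Σ_{n ≤ y} Λ(n) n^{-1/2}` against `ψ` and `ψ₁`: Abel summation and one integration by parts -/

/-- `Λ(n)/√n = n^{-1/2}·Λ(n)`. [folklore] -/
private theorem vonMangoldt_div_sqrt_eq (n : ℕ) :
    Λ n / Real.sqrt n = (n : ℝ) ^ (-(1 / 2 : ℝ)) * Λ n := by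
  rw [Real.sqrt_eq_rpow, Real.rpow_neg (Nat.cast_nonneg n), div_eq_inv_mul]

/-- **Abel summation**: `Π(y) = ψ(y) y^{-1/2} + ½ ∫₁ʸ ψ(t) t^{-3/2} dt` for `y ≥ 1`.
[cite: Suzuki2025Chebyshev, §2 (2.5)–(2.6) (partial summation for `ψ_{1/2}`)] -/
theorem primeCount_eq_abel {y : ℝ} (hy : 1 ≤ y) :
    ∑ n ∈ Finset.Icc 1 ⌊y⌋₊, Λ n / Real.sqrt n =
      ψ y * y ^ (-(1 / 2 : ℝ)) + 1 / 2 * ∫ t in (1 : ℝ)..y, ψ t * t ^ (-(3 / 2 : ℝ)) := by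
  have hderiv : deriv (fun t : ℝ ↦ t ^ (-(1 / 2 : ℝ))) = fun t ↦ -(1 / 2) * t ^ (-(3 / 2 : ℝ)) := by
    funext t
    rw [Real.deriv_rpow_const]
    norm_num
  have hdiff : ∀ t ∈ Icc (1 : ℝ) y, DifferentiableAt ℝ (fun t : ℝ ↦ t ^ (-(1 / 2 : ℝ))) t :=
    fun t ht ↦ (Real.hasDerivAt_rpow_const (p := -(1 / 2 : ℝ))
      (Or.inl (by linarith [ht.1] : t ≠ 0))).differentiableAt
  have hcont : ContinuousOn (fun t : ℝ ↦ -(1 / 2) * t ^ (-(3 / 2 : ℝ))) (Icc 1 y) :=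
    continuousOn_const.mul
      (continuousOn_id.rpow_const fun t ht ↦ Or.inl (by linarith [ht.1] : (t : ℝ) ≠ 0))
  have hint : IntegrableOn (deriv (fun t : ℝ ↦ t ^ (-(1 / 2 : ℝ)))) (Icc 1 y) := by
    rw [hderiv]; exact hcont.integrableOn_Icc
  have h := sum_mul_eq_sub_sub_integral_mul (𝕜 := ℝ) (fun n ↦ (Λ n : ℝ))
    (f := fun t : ℝ ↦ t ^ (-(1 / 2 : ℝ))) zero_le_one hy hdiff hint
  rw [hderiv] at h
  simp only [← Chebyshev.psi_eq_sum_Icc] at h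
  rw [Nat.floor_one, Chebyshev.psi_one, mul_zero, sub_zero, ← intervalIntegral.integral_of_le hy] at h
  have hsplit : ∑ n ∈ Finset.Icc 1 ⌊y⌋₊, Λ n / Real.sqrt n =
      ∑ n ∈ Finset.Ioc 1 ⌊y⌋₊, (n : ℝ) ^ (-(1 / 2 : ℝ)) * Λ n := by
    have h1 : 1 ≤ ⌊y⌋₊ := Nat.le_floor (by exact_mod_cast hy)
    rw [Finset.Icc_eq_cons_Ioc h1, Finset.sum_cons, ArithmeticFunction.vonMangoldt_apply_one,
      zero_div, zero_add]
    exact Finset.sum_congr rfl fun n _ ↦ vonMangoldt_div_sqrt_eq n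
  rw [hsplit, h]
  have hI : ∫ t in (1 : ℝ)..y, -(1 / 2) * t ^ (-(3 / 2 : ℝ)) * ψ t =
      -(1 / 2) * ∫ t in (1 : ℝ)..y, ψ t * t ^ (-(3 / 2 : ℝ)) := by
    rw [← intervalIntegral.integral_const_mul]
    congr 1; funext t; ring
  rw [hI]; ring

/-- `ψ₁(1) = 0`. [folklore] -/
private theorem psiOne_one : psiOne 1 = 0 := by
  rw [psiOne, Nat.floor_one, show Finset.Ioc 0 1 = ({1} : Finset ℕ) from by decide,
    Finset.sum_singleton]
  simp

/-- **Integration by parts** (`ψ₁' = ψ` from the right, `ψ₁(1) = 0`):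
`∫₁ʸ ψ(t) t^{-3/2} dt = ψ₁(y) y^{-3/2} + (3/2) ∫₁ʸ ψ₁(t) t^{-5/2} dt` for `y ≥ 1`. [folklore] -/
private theorem integral_psi_mul_rpow {y : ℝ} (hy : 1 ≤ y) :
    ∫ t in (1 : ℝ)..y, ψ t * t ^ (-(3 / 2 : ℝ)) =
      psiOne y * y ^ (-(3 / 2 : ℝ)) + 3 / 2 * ∫ t in (1 : ℝ)..y, psiOne t * t ^ (-(5 / 2 : ℝ)) := by
  have hIcc : uIcc (1 : ℝ) y = Icc 1 y := uIcc_of_le hy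
  have hv : ∀ t ∈ Icc (1 : ℝ) y,
      HasDerivAt (fun t : ℝ ↦ t ^ (-(3 / 2 : ℝ))) (-(3 / 2) * t ^ (-(5 / 2 : ℝ))) t := by
    intro t ht
    have := Real.hasDerivAt_rpow_const (p := -(3 / 2 : ℝ)) (Or.inl (by linarith [ht.1] : t ≠ 0))
    convert this using 2; norm_num
  have hvc : ContinuousOn (fun t : ℝ ↦ t ^ (-(3 / 2 : ℝ))) (uIcc 1 y) := by
    rw [hIcc]
    exact continuousOn_id.rpow_const fun t ht ↦ Or.inl (by linarith [ht.1] : (t : ℝ) ≠ 0)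
  have hv'c : ContinuousOn (fun t : ℝ ↦ -(3 / 2) * t ^ (-(5 / 2 : ℝ))) (uIcc 1 y) := by
    rw [hIcc]
    exact continuousOn_const.mul
      (continuousOn_id.rpow_const fun t ht ↦ Or.inl (by linarith [ht.1] : (t : ℝ) ≠ 0))
  have h := intervalIntegral.integral_deriv_mul_eq_sub_of_hasDeriv_right (u := psiOne)
    (v := fun t : ℝ ↦ t ^ (-(3 / 2 : ℝ))) (u' := ψ) (v' := fun t ↦ -(3 / 2) * t ^ (-(5 / 2 : ℝ)))
    (a := 1) (b := y) continuous_psiOne.continuousOn hvc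
    (fun t _ ↦ hasDerivWithinAt_psiOne t)
    (fun t ht ↦ (hv t (by
      rw [min_eq_left hy, max_eq_right hy] at ht
      exact ⟨ht.1.le, ht.2.le⟩)).hasDerivWithinAt)
    (intervalIntegrable_psi 1 y) hv'c.intervalIntegrable
  have hi1 : IntervalIntegrable (fun t ↦ ψ t * t ^ (-(3 / 2 : ℝ))) volume 1 y :=
    (intervalIntegrable_psi 1 y).mul_continuousOn hvc
  have hi2 : IntervalIntegrable (fun t ↦ psiOne t * (-(3 / 2) * t ^ (-(5 / 2 : ℝ)))) volume 1 y :=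
    hv'c.intervalIntegrable.continuousOn_mul (continuous_psiOne.continuousOn)
  rw [intervalIntegral.integral_add hi1 hi2, psiOne_one, zero_mul, sub_zero] at h
  have hI : ∫ t in (1 : ℝ)..y, psiOne t * (-(3 / 2) * t ^ (-(5 / 2 : ℝ))) =
      -(3 / 2) * ∫ t in (1 : ℝ)..y, psiOne t * t ^ (-(5 / 2 : ℝ)) := by
    rw [← intervalIntegral.integral_const_mul]
    congr 1; funext t; ring
  rw [hI] at h
  linarith

/-- **`Π(y)` through `R₁ = ψ₁ − t²/2`**: for `y ≥ 1`,
`Π(y) = ψ(y) y^{-1/2} + y^{1/2} − 3/4 + ½R₁(y) y^{-3/2} + (3/4)∫₁ʸ R₁(t) t^{-5/2} dt`. [folklore] -/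
private theorem primeCount_eq_Rone {y : ℝ} (hy : 1 ≤ y) :
    ∑ n ∈ Finset.Icc 1 ⌊y⌋₊, Λ n / Real.sqrt n =
      ψ y * y ^ (-(1 / 2 : ℝ)) + y ^ (1 / 2 : ℝ) - 3 / 4 + 1 / 2 * Rone y * y ^ (-(3 / 2 : ℝ))
        + 3 / 4 * ∫ t in (1 : ℝ)..y, Rone t * t ^ (-(5 / 2 : ℝ)) := by
  have hy0 : 0 < y := by linarith
  rw [primeCount_eq_abel hy, integral_psi_mul_rpow hy]
  have hR : ∀ t, psiOne t = Rone t + t ^ 2 / 2 := fun t ↦ by simp [Rone]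
  have hIcc : uIcc (1 : ℝ) y = Icc 1 y := uIcc_of_le hy
  have hc5 : ContinuousOn (fun t : ℝ ↦ t ^ (-(5 / 2 : ℝ))) (uIcc 1 y) := by
    rw [hIcc]
    exact continuousOn_id.rpow_const fun t ht ↦ Or.inl (by linarith [ht.1] : (t : ℝ) ≠ 0)
  have hc1 : ContinuousOn (fun t : ℝ ↦ 1 / 2 * t ^ (-(1 / 2 : ℝ))) (uIcc 1 y) := by
    rw [hIcc]
    exact continuousOn_const.mul
      (continuousOn_id.rpow_const fun t ht ↦ Or.inl (by linarith [ht.1] : (t : ℝ) ≠ 0))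
  have hmain : ∫ t in (1 : ℝ)..y, psiOne t * t ^ (-(5 / 2 : ℝ)) =
      (∫ t in (1 : ℝ)..y, Rone t * t ^ (-(5 / 2 : ℝ))) + (y ^ (1 / 2 : ℝ) - 1) := by
    have heq : EqOn (fun t ↦ psiOne t * t ^ (-(5 / 2 : ℝ)))
        (fun t ↦ Rone t * t ^ (-(5 / 2 : ℝ)) + 1 / 2 * t ^ (-(1 / 2 : ℝ))) (uIcc 1 y) := by
      intro t ht
      rw [hIcc] at ht
      have ht0 : 0 < t := by linarith [ht.1]
      simp only [hR, add_mul]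
      congr 1
      rw [show (-(1 / 2 : ℝ)) = 2 + (-(5 / 2 : ℝ)) by norm_num, Real.rpow_add ht0, Real.rpow_two]
      ring
    have hi1 : IntervalIntegrable (fun t : ℝ ↦ Rone t * t ^ (-(5 / 2 : ℝ))) volume 1 y :=
      (continuous_Rone.continuousOn.mul hc5).intervalIntegrable
    have hi2 : IntervalIntegrable (fun t : ℝ ↦ 1 / 2 * t ^ (-(1 / 2 : ℝ))) volume 1 y :=
      hc1.intervalIntegrable
    rw [intervalIntegral.integral_congr heq, intervalIntegral.integral_add hi1 hi2,
      intervalIntegral.integral_const_mul, integral_rpow (Or.inl (by norm_num))]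
    rw [Real.one_rpow]
    norm_num
    ring
  rw [hmain, hR y]
  have he : y ^ 2 * y ^ (-(3 / 2 : ℝ)) = y ^ (1 / 2 : ℝ) := by
    rw [← Real.rpow_two, ← Real.rpow_add hy0]; norm_num
  linear_combination (1 / 4 : ℝ) * he

/-! ### §2 The zero sum of the `ψ₁` formula, integrated termwise against `t^{-5/2}` (under RH) -/

/-- `t ↦ (t : ℂ)^s` is continuous on `(0, ∞)`. [folklore] -/
private theorem continuousOn_ofReal_cpow (s : ℂ) : ContinuousOn (fun t : ℝ ↦ (t : ℂ) ^ s) (Ioi 0) :=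
  fun t ht ↦ (Complex.continuousAt_ofReal_cpow_const t s (Or.inr (ne_of_gt ht))).continuousWithinAt

/-- The weight `t^{-5/2}` as a complex number: `(t:ℂ)^{ρ+1} · t^{-5/2} = (t:ℂ)^{ρ − 3/2}` (`t > 0`).
[folklore] -/
private theorem cpow_mul_weight {t : ℝ} (ht : 0 < t) (ρ : ℂ) :
    (t : ℂ) ^ (ρ + 1) * ((t ^ (-(5 / 2 : ℝ)) : ℝ) : ℂ) = (t : ℂ) ^ (ρ - 3 / 2) := by
  rw [Complex.ofReal_cpow ht.le, ← Complex.cpow_add _ _ (by exact_mod_cast ht.ne')]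
  congr 1
  push_cast
  ring

/-- `zeroTerm ρ t · t^{-5/2} = (m(ρ)/(ρ(ρ+1))) · t^{ρ − 3/2}` (`t > 0`). [folklore] -/
private theorem zeroTerm_mul_weight {t : ℝ} (ht : 0 < t) (ρ : Zeros) :
    zeroTerm ρ t * ((t ^ (-(5 / 2 : ℝ)) : ℝ) : ℂ) =
      (riemannZetaZeroOrder (ρ : ℂ) : ℂ) / ((ρ : ℂ) * (ρ + 1)) * (t : ℂ) ^ ((ρ : ℂ) - 3 / 2) := by
  rw [zeroTerm, ← cpow_mul_weight ht]
  ring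

/-- **The termwise integral**: `∫₁ʸ zeroTerm ρ t · t^{-5/2} dt = (m(ρ)/(ρ(ρ+1))) (y^{ρ−½} − 1)/(ρ − ½)`
(`y ≥ 1`). [folklore] -/
private theorem integral_zeroTerm_mul_weight (ρ : Zeros) {y : ℝ} (hy : 1 ≤ y) :
    ∫ t in (1 : ℝ)..y, zeroTerm ρ t * ((t ^ (-(5 / 2 : ℝ)) : ℝ) : ℂ) =
      (riemannZetaZeroOrder (ρ : ℂ) : ℂ) / ((ρ : ℂ) * (ρ + 1)) *
        (((y : ℂ) ^ ((ρ : ℂ) - 1 / 2) - 1) / ((ρ : ℂ) - 1 / 2)) := by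
  have heq : EqOn (fun t : ℝ ↦ zeroTerm ρ t * ((t ^ (-(5 / 2 : ℝ)) : ℝ) : ℂ))
      (fun t : ℝ ↦ (riemannZetaZeroOrder (ρ : ℂ) : ℂ) / ((ρ : ℂ) * (ρ + 1)) *
        (t : ℂ) ^ ((ρ : ℂ) - 3 / 2)) (uIcc 1 y) := by
    intro t ht
    rw [uIcc_of_le hy] at ht
    exact zeroTerm_mul_weight (by linarith [ht.1]) ρ
  have him : ((ρ : ℂ)).im ≠ 0 := ZetaZeros.riemannZetaNontrivialZeros.im_ne_zero ρ.2
  have hr : (ρ : ℂ) - 3 / 2 ≠ -1 := by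
    intro h
    have := congrArg Complex.im h
    simp at this
    exact him this
  have h0 : (0 : ℝ) ∉ uIcc (1 : ℝ) y := by
    rw [uIcc_of_le hy]; intro h; exact absurd h.1 (by norm_num)
  rw [intervalIntegral.integral_congr heq, intervalIntegral.integral_const_mul,
    integral_cpow (Or.inr ⟨hr, h0⟩)]
  congr 1
  push_cast
  rw [Complex.one_cpow, show ((ρ : ℂ) - 3 / 2 + 1) = (ρ : ℂ) - 1 / 2 by ring]

/-- **Under RH the termwise integral is bounded by `(m(ρ)/|ρ|²)/δ`** when `|Im ρ| ≥ 2δ` (`y ≥ 1`):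
`|y^{ρ−½}| = 1`, `|ρ − ½| ≥ |Im ρ| ≥ 2δ`, `|ρ(ρ+1)| ≥ |ρ|²`. [folklore] -/
private theorem norm_integral_zeroTerm_mul_weight_le (hRH : RiemannHypothesis) {δ : ℝ} (hδ : 0 < δ)
    (ρ : Zeros) (hgap : 2 * δ ≤ |((ρ : ℂ)).im|) {y : ℝ} (hy : 1 ≤ y) :
    ‖∫ t in (1 : ℝ)..y, zeroTerm ρ t * ((t ^ (-(5 / 2 : ℝ)) : ℝ) : ℂ)‖ ≤
      (riemannZetaZeroOrder (ρ : ℂ) : ℝ) / ‖(ρ : ℂ)‖ ^ 2 * (1 / δ) := by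
  have hy0 : 0 < y := by linarith
  have hre := re_eq_half_of_RH hRH ρ.2
  have hm := zeroOrder_nonneg' ρ
  have hn0 : 0 < ‖(ρ : ℂ)‖ := norm_pos_iff.2 (ne_zero ρ.2)
  have hn1 : ‖(ρ : ℂ)‖ ≤ ‖(ρ : ℂ) + 1‖ := norm_le_norm_add_one ρ.2
  rw [integral_zeroTerm_mul_weight ρ hy, norm_mul, norm_div, Complex.norm_intCast, abs_of_nonneg hm,
    norm_mul, norm_div]
  -- numerator `‖y^{ρ−½} − 1‖ ≤ 2`
  have hnum : ‖(y : ℂ) ^ ((ρ : ℂ) - 1 / 2) - 1‖ ≤ 2 := by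
    refine (norm_sub_le _ _).trans ?_
    rw [Complex.norm_cpow_eq_rpow_re_of_pos hy0, sub_re, hre, norm_one]
    norm_num
  -- denominator `‖ρ − ½‖ ≥ 2δ`
  have hden : 2 * δ ≤ ‖(ρ : ℂ) - 1 / 2‖ := by
    refine hgap.trans ?_
    have := Complex.abs_im_le_norm ((ρ : ℂ) - 1 / 2)
    simpa using this
  have hden0 : 0 < ‖(ρ : ℂ) - 1 / 2‖ := by linarith
  have h1 : ‖(y : ℂ) ^ ((ρ : ℂ) - 1 / 2) - 1‖ / ‖(ρ : ℂ) - 1 / 2‖ ≤ 1 / δ := by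
    rw [div_le_div_iff₀ hden0 hδ]
    nlinarith
  have h2 : (riemannZetaZeroOrder (ρ : ℂ) : ℝ) / (‖(ρ : ℂ)‖ * ‖(ρ : ℂ) + 1‖) ≤
      (riemannZetaZeroOrder (ρ : ℂ) : ℝ) / ‖(ρ : ℂ)‖ ^ 2 := by
    refine div_le_div_of_nonneg_left hm (pow_pos hn0 2) ?_
    rw [sq]
    exact mul_le_mul_of_nonneg_left hn1 hn0.le
  exact mul_le_mul h2 h1 (div_nonneg (norm_nonneg _) (norm_nonneg _))
    (div_nonneg hm (pow_nonneg (norm_nonneg _) 2))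

/-- Each `zeroTerm ρ · t^{-5/2}` is continuous on `[1, y]`. [folklore] -/
private theorem continuousOn_zeroTerm_mul_weight (ρ : Zeros) (y : ℝ) :
    ContinuousOn (fun t : ℝ ↦ zeroTerm ρ t * ((t ^ (-(5 / 2 : ℝ)) : ℝ) : ℂ)) (Icc 1 y) := by
  have h1 : ContinuousOn (fun t : ℝ ↦ zeroTerm ρ t) (Icc 1 y) := by
    simp only [zeroTerm]
    refine continuousOn_const.mul (ContinuousOn.div_const ?_ _)
    exact (continuousOn_ofReal_cpow _).mono fun t ht ↦ lt_of_lt_of_le one_pos ht.1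
  refine h1.mul (Complex.continuous_ofReal.comp_continuousOn ?_)
  exact continuousOn_id.rpow_const fun t ht ↦ Or.inl (by linarith [ht.1] : (t : ℝ) ≠ 0)

/-- Under RH, `‖zeroTerm ρ t · t^{-5/2}‖ ≤ m(ρ)/|ρ|²` for `t ≥ 1`. [folklore] -/
private theorem norm_zeroTerm_mul_weight_le (hRH : RiemannHypothesis) (ρ : Zeros) {t : ℝ} (ht : 1 ≤ t) :
    ‖zeroTerm ρ t * ((t ^ (-(5 / 2 : ℝ)) : ℝ) : ℂ)‖ ≤
      (riemannZetaZeroOrder (ρ : ℂ) : ℝ) / ‖(ρ : ℂ)‖ ^ 2 := by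
  have ht0 : 0 < t := by linarith
  have hK : 0 ≤ (riemannZetaZeroOrder (ρ : ℂ) : ℝ) / ‖(ρ : ℂ)‖ ^ 2 :=
    div_nonneg (zeroOrder_nonneg' ρ) (sq_nonneg _)
  rw [norm_mul, Complex.norm_real, Real.norm_eq_abs, abs_of_nonneg (Real.rpow_nonneg ht0.le _)]
  calc ‖zeroTerm ρ t‖ * t ^ (-(5 / 2 : ℝ))
      ≤ ((riemannZetaZeroOrder (ρ : ℂ) : ℝ) / ‖(ρ : ℂ)‖ ^ 2 * t ^ (3 / 2 : ℝ)) * t ^ (-(5 / 2 : ℝ)) :=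
        mul_le_mul_of_nonneg_right (norm_zeroTerm_le hRH ρ ht0) (Real.rpow_nonneg ht0.le _)
    _ = (riemannZetaZeroOrder (ρ : ℂ) : ℝ) / ‖(ρ : ℂ)‖ ^ 2 * t ^ (-1 : ℝ) := by
        rw [mul_assoc, ← Real.rpow_add ht0]; norm_num
    _ ≤ (riemannZetaZeroOrder (ρ : ℂ) : ℝ) / ‖(ρ : ℂ)‖ ^ 2 * 1 := by
        refine mul_le_mul_of_nonneg_left ?_ hK
        rw [Real.rpow_neg_one]
        exact inv_le_one_of_one_le₀ ht
    _ = _ := mul_one _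

/-- **Under RH, `∫₁ʸ Z(t) t^{-5/2} dt = Σ_ρ ∫₁ʸ zeroTerm ρ t · t^{-5/2} dt`** (dominated convergence:
the norms integrate to `≤ (m(ρ)/|ρ|²)(y − 1)`, summable by `Σ m(ρ)/|ρ|² = β`). [folklore] -/
private theorem integral_Zsum_mul_weight (hRH : RiemannHypothesis) {y : ℝ} (hy : 1 ≤ y) :
    ∫ t in (1 : ℝ)..y, Zsum t * ((t ^ (-(5 / 2 : ℝ)) : ℝ) : ℂ) =
      ∑' ρ : Zeros, ∫ t in (1 : ℝ)..y, zeroTerm ρ t * ((t ^ (-(5 / 2 : ℝ)) : ℝ) : ℂ) := by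
  simp only [intervalIntegral.integral_of_le hy]
  have hint : ∀ ρ : Zeros, Integrable (fun t : ℝ ↦ zeroTerm ρ t * ((t ^ (-(5 / 2 : ℝ)) : ℝ) : ℂ))
      (volume.restrict (Ioc 1 y)) := fun ρ ↦
    ((continuousOn_zeroTerm_mul_weight ρ y).integrableOn_Icc).mono_set Ioc_subset_Icc_self
  have hsum : Summable fun ρ : Zeros ↦
      ∫ t, ‖zeroTerm ρ t * ((t ^ (-(5 / 2 : ℝ)) : ℝ) : ℂ)‖ ∂(volume.restrict (Ioc 1 y)) := by
    have hS := (hasSum_zeroOrder_div_norm_sq_of_RH hRH).summable.mul_right (y - 1)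
    refine Summable.of_nonneg_of_le (fun ρ ↦ integral_nonneg fun t ↦ norm_nonneg _) (fun ρ ↦ ?_) hS
    have h := norm_setIntegral_le_of_norm_le_const (s := Ioc 1 y) (μ := volume)
      (f := fun t : ℝ ↦ ‖zeroTerm ρ t * ((t ^ (-(5 / 2 : ℝ)) : ℝ) : ℂ)‖)
      (C := (riemannZetaZeroOrder (ρ : ℂ) : ℝ) / ‖(ρ : ℂ)‖ ^ 2) measure_Ioc_lt_top
      (fun t ht ↦ by rw [norm_norm]; exact norm_zeroTerm_mul_weight_le hRH ρ ht.1.le)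
    rw [Real.norm_of_nonneg (integral_nonneg fun t ↦ norm_nonneg _), Real.volume_real_Ioc,
      max_eq_left (by linarith)] at h
    exact h
  rw [integral_tsum_of_summable_integral_norm hint hsum]
  refine integral_congr_ae (ae_of_all _ fun t ↦ ?_)
  simp only [Zsum]
  exact tsum_mul_right.symm

/-- **Under RH, `‖∫₁ʸ Z(t) t^{-5/2} dt‖ ≤ β/δ`** uniformly in `y ≥ 1` (`2δ` the gap of the zeros off
the real axis). [folklore] -/
private theorem norm_integral_Zsum_mul_weight_le (hRH : RiemannHypothesis) {δ : ℝ} (hδ : 0 < δ)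
    (hgap : ∀ ρ ∈ RHWave0.riemannZetaNontrivialZeros, 2 * δ ≤ |ρ.im|) {y : ℝ} (hy : 1 ≤ y) :
    ‖∫ t in (1 : ℝ)..y, Zsum t * ((t ^ (-(5 / 2 : ℝ)) : ℝ) : ℂ)‖ ≤ nicolasBeta / δ := by
  rw [integral_Zsum_mul_weight hRH hy]
  have hS := (hasSum_zeroOrder_div_norm_sq_of_RH hRH).mul_right (1 / δ)
  have hle : ∀ ρ : Zeros, ‖∫ t in (1 : ℝ)..y, zeroTerm ρ t * ((t ^ (-(5 / 2 : ℝ)) : ℝ) : ℂ)‖ ≤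
      (riemannZetaZeroOrder (ρ : ℂ) : ℝ) / ‖(ρ : ℂ)‖ ^ 2 * (1 / δ) :=
    fun ρ ↦ norm_integral_zeroTerm_mul_weight_le hRH hδ ρ (hgap _ ρ.2) hy
  have hsum : Summable fun ρ : Zeros ↦
      ‖∫ t in (1 : ℝ)..y, zeroTerm ρ t * ((t ^ (-(5 / 2 : ℝ)) : ℝ) : ℂ)‖ :=
    Summable.of_nonneg_of_le (fun _ ↦ norm_nonneg _) hle hS.summable
  calc _ ≤ ∑' ρ : Zeros, ‖∫ t in (1 : ℝ)..y, zeroTerm ρ t * ((t ^ (-(5 / 2 : ℝ)) : ℝ) : ℂ)‖ :=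
        norm_tsum_le_tsum_norm hsum
    _ ≤ ∑' ρ : Zeros, (riemannZetaZeroOrder (ρ : ℂ) : ℝ) / ‖(ρ : ℂ)‖ ^ 2 * (1 / δ) :=
        hsum.tsum_le_tsum hle hS.summable
    _ = nicolasBeta / δ := by rw [hS.tsum_eq]; ring


/-! ### §3 Under RH: `Π(y) = ψ(y)/√y + √y + O(1)` and `D(y) = 2 Re Σ_{|γ|≤T} y^ρ/ρ /√y + O(1)` -/

/-- `log(2π) ≥ 0`. [folklore] -/
private theorem log_two_pi_nonneg : 0 ≤ Real.log (2 * π) :=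
  Real.log_nonneg (by linarith [Real.pi_gt_three])

/-- **Under RH, `|∫₁ʸ R₁(t) t^{-5/2} dt| ≤ β/δ + 2(log 2π + C_E)`** uniformly in `y ≥ 1`
(`R₁ = −Re Z − (log 2π)t + Re E`, the zero sum integrated termwise, `|E(t)| ≤ C_E √t`).
[cite: MontgomeryVaughan2007, (13.7)–(13.8)] -/
theorem exists_abs_integral_Rone_mul_weight_le (hRH : RiemannHypothesis) :
    ∃ K : ℝ, ∀ y : ℝ, 1 ≤ y → |∫ t in (1 : ℝ)..y, Rone t * t ^ (-(5 / 2 : ℝ))| ≤ K := by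
  obtain ⟨δ, hδ, -, hgap⟩ := ZetaZeroSum.exists_gap_im
  obtain ⟨C, hC0, hC⟩ := exists_norm_psiOneRemainder_le
  refine ⟨nicolasBeta / δ + 2 * (Real.log (2 * π) + C), fun y hy ↦ ?_⟩
  have hy0 : 0 < y := by linarith
  have hIcc : uIcc (1 : ℝ) y = Icc 1 y := uIcc_of_le hy
  have hL := log_two_pi_nonneg
  set w : ℝ → ℂ := fun t ↦ ((t ^ (-(5 / 2 : ℝ)) : ℝ) : ℂ) with hw
  have hwc : ContinuousOn w (Icc 1 y) := Complex.continuous_ofReal.comp_continuousOn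
    (continuousOn_id.rpow_const fun t ht ↦ Or.inl (by linarith [ht.1] : (t : ℝ) ≠ 0))
  -- the real integral is the real part of a complex one
  have hreal : (∫ t in (1 : ℝ)..y, Rone t * t ^ (-(5 / 2 : ℝ))) =
      (∫ t in (1 : ℝ)..y, (Rone t : ℂ) * w t).re := by
    have : (fun t ↦ (Rone t : ℂ) * w t) = fun t ↦ ((Rone t * t ^ (-(5 / 2 : ℝ)) : ℝ) : ℂ) := by
      funext t; simp [hw]
    rw [this, intervalIntegral.integral_ofReal, Complex.ofReal_re]
  have hZc : ContinuousOn (fun t ↦ Zsum t * w t) (uIcc 1 y) := by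
    rw [hIcc]; exact (continuousOn_Zsum_Icc y).mul hwc
  have hRc : ContinuousOn (fun t ↦ (Rone t : ℂ) * w t) (uIcc 1 y) := by
    rw [hIcc]; exact (Complex.continuous_ofReal.comp continuous_Rone).continuousOn.mul hwc
  have hiZ : IntervalIntegrable (fun t ↦ Zsum t * w t) volume 1 y := hZc.intervalIntegrable
  have hiR : IntervalIntegrable (fun t ↦ (Rone t : ℂ) * w t) volume 1 y := hRc.intervalIntegrable
  have hsplit : ∫ t in (1 : ℝ)..y, (Rone t : ℂ) * w t =
      -(∫ t in (1 : ℝ)..y, Zsum t * w t) +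
        ∫ t in (1 : ℝ)..y, ((Rone t : ℂ) * w t + Zsum t * w t) := by
    rw [intervalIntegral.integral_add hiR hiZ]; ring
  -- the non-zero part `(−(log 2π) t + E(t)) t^{-5/2}` is `≤ (log 2π + C) t^{-3/2}` in norm
  have hg : ∀ t ∈ Icc (1 : ℝ) y,
      ‖(Rone t : ℂ) * w t + Zsum t * w t‖ ≤ (Real.log (2 * π) + C) * t ^ (-(3 / 2 : ℝ)) := by
    intro t ht
    have ht1 : 1 ≤ t := ht.1
    have ht0 : 0 < t := by linarith
    have hE := hC t ht0
    have hsq : Real.sqrt t ≤ t := by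
      nlinarith [Real.mul_self_sqrt ht0.le, Real.one_le_sqrt.mpr ht1, Real.sqrt_nonneg t]
    have e : (Rone t : ℂ) * w t + Zsum t * w t =
        (-(((t * Real.log (2 * π) : ℝ) : ℂ)) + psiOneRemainder t) * w t := by
      rw [Rone_eq_explicit ht1, log_two_pi]; push_cast; ring
    rw [e, norm_mul, hw]
    simp only
    rw [Complex.norm_real, Real.norm_of_nonneg (Real.rpow_nonneg ht0.le _)]
    have h1 : ‖-(((t * Real.log (2 * π) : ℝ) : ℂ)) + psiOneRemainder t‖ ≤
        (Real.log (2 * π) + C) * t := by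
      refine (norm_add_le _ _).trans ?_
      rw [norm_neg, Complex.norm_real, Real.norm_of_nonneg (by positivity)]
      nlinarith [hE, hC0.le]
    calc ‖-(((t * Real.log (2 * π) : ℝ) : ℂ)) + psiOneRemainder t‖ * t ^ (-(5 / 2 : ℝ))
        ≤ (Real.log (2 * π) + C) * t * t ^ (-(5 / 2 : ℝ)) :=
          mul_le_mul_of_nonneg_right h1 (Real.rpow_nonneg ht0.le _)
      _ = (Real.log (2 * π) + C) * t ^ (-(3 / 2 : ℝ)) := by
          rw [mul_assoc]
          congr 1
          rw [show (-(3 / 2 : ℝ)) = 1 + (-(5 / 2 : ℝ)) by norm_num, Real.rpow_add ht0, Real.rpow_one]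
  have hgi : IntervalIntegrable (fun t : ℝ ↦ (Real.log (2 * π) + C) * t ^ (-(3 / 2 : ℝ))) volume 1 y := by
    refine ContinuousOn.intervalIntegrable ?_
    rw [hIcc]
    exact continuousOn_const.mul
      (continuousOn_id.rpow_const fun t ht ↦ Or.inl (by linarith [ht.1] : (t : ℝ) ≠ 0))
  have hnorm_g : ‖∫ t in (1 : ℝ)..y, ((Rone t : ℂ) * w t + Zsum t * w t)‖ ≤
      2 * (Real.log (2 * π) + C) := by
    refine (intervalIntegral.norm_integral_le_of_norm_le hy
      (ae_of_all _ fun t ht ↦ hg t ⟨ht.1.le, ht.2⟩) hgi).trans ?_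
    have h0 : (0 : ℝ) ∉ uIcc (1 : ℝ) y := by
      rw [hIcc]; intro h; exact absurd h.1 (by norm_num)
    rw [intervalIntegral.integral_const_mul, integral_rpow (Or.inr ⟨by norm_num, h0⟩), Real.one_rpow]
    have hy' : 0 ≤ y ^ (-(3 / 2 : ℝ) + 1) := Real.rpow_nonneg hy0.le _
    norm_num at hy' ⊢
    nlinarith
  have hnorm_Z := norm_integral_Zsum_mul_weight_le hRH hδ hgap hy
  rw [hreal]
  refine (Complex.abs_re_le_norm _).trans ?_
  rw [hsplit]
  refine (norm_add_le _ _).trans ?_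
  rw [norm_neg]
  exact add_le_add hnorm_Z hnorm_g

/-- **Under RH: `Π(y) = ψ(y)/√y + √y + O(1)`**, uniformly for `y ≥ 1` (the `T`-free half of the
comparison; from §1–§2). [cite: Suzuki2025Chebyshev, §2 (2.6) (the shape of `ψ_{1/2}` under RH)] -/
theorem exists_abs_primeCount_sub_le (hRH : RiemannHypothesis) :
    ∃ K : ℝ, ∀ y : ℝ, 1 ≤ y →
      |∑ n ∈ Finset.Icc 1 ⌊y⌋₊, Λ n / Real.sqrt n - ψ y / Real.sqrt y - Real.sqrt y| ≤ K := by
  obtain ⟨K₁, hK₁⟩ := exists_abs_integral_Rone_mul_weight_le hRH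
  obtain ⟨C, hC⟩ := exists_abs_Rone_le_of_RH hRH
  refine ⟨3 / 4 + C / 2 + 3 / 4 * K₁, fun y hy ↦ ?_⟩
  have hy0 : 0 < y := by linarith
  rw [primeCount_eq_Rone hy]
  have hs : Real.sqrt y = y ^ (1 / 2 : ℝ) := Real.sqrt_eq_rpow y
  have hs' : ψ y / Real.sqrt y = ψ y * y ^ (-(1 / 2 : ℝ)) := by
    rw [hs, Real.rpow_neg hy0.le, div_eq_mul_inv]
  rw [hs', hs]
  have e : ψ y * y ^ (-(1 / 2 : ℝ)) + y ^ (1 / 2 : ℝ) - 3 / 4 + 1 / 2 * Rone y * y ^ (-(3 / 2 : ℝ))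
      + 3 / 4 * (∫ t in (1 : ℝ)..y, Rone t * t ^ (-(5 / 2 : ℝ)))
      - ψ y * y ^ (-(1 / 2 : ℝ)) - y ^ (1 / 2 : ℝ) =
      -(3 / 4) + 1 / 2 * (Rone y * y ^ (-(3 / 2 : ℝ)))
        + 3 / 4 * (∫ t in (1 : ℝ)..y, Rone t * t ^ (-(5 / 2 : ℝ))) := by ring
  rw [e]
  have h1 : |Rone y * y ^ (-(3 / 2 : ℝ))| ≤ C := by
    rw [abs_mul, abs_of_nonneg (Real.rpow_nonneg hy0.le _)]
    calc |Rone y| * y ^ (-(3 / 2 : ℝ)) ≤ C * y ^ (3 / 2 : ℝ) * y ^ (-(3 / 2 : ℝ)) :=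
          mul_le_mul_of_nonneg_right (hC y hy) (Real.rpow_nonneg hy0.le _)
      _ = C := by rw [mul_assoc, ← Real.rpow_add hy0]; norm_num
  have h2 := hK₁ y hy
  rw [abs_le] at h1 h2 ⊢
  constructor <;> linarith [h1.1, h1.2, h2.1, h2.2]

/-- The error of Montgomery–Vaughan's Thm 12.5 at a fixed `y ≥ 2` tends to `0` as `T → ∞`
(`⟨y⟩ > 0`): an explicit majorant valid for `T ≥ y`. [cite: MontgomeryVaughan2007, Thm 12.5 (12.4)] -/
theorem tendsto_truncationError {y : ℝ} (C : ℝ) :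
    Tendsto (fun T : ℝ ↦ max C 0 * (Real.log y * (y / primePowDist y) * T⁻¹ +
      4 * y * (Real.log T ^ 2 / T))) atTop (𝓝 0) := by
  have h1 : Tendsto (fun T : ℝ ↦ Real.log y * (y / primePowDist y) * T⁻¹) atTop (𝓝 0) := by
    simpa using tendsto_inv_atTop_zero.const_mul (Real.log y * (y / primePowDist y))
  have h2 : Tendsto (fun T : ℝ ↦ 4 * y * (Real.log T ^ 2 / T)) atTop (𝓝 0) := by
    have := (Real.isLittleO_pow_log_id_atTop (n := 2)).tendsto_div_nhds_zero
    simpa using this.const_mul (4 * y)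
  simpa using (h1.add h2).const_mul (max C 0)

/-- **MV Thm 12.5 at a single point, `T → ∞`**: for `y ≥ 2`, eventually in `T`,
`|y − ψ(y) − Re Σ_{|γ|≤T} m(ρ) y^ρ/ρ| ≤ 8 + ½ log y` and `|Im Σ_{|γ|≤T} m(ρ) y^ρ/ρ| ≤ 1`.
[cite: MontgomeryVaughan2007, Thm 12.5 (12.3)–(12.4)] -/
theorem eventually_abs_sub_re_zetaZeroSumTrunc_le {y : ℝ} (hy : 2 ≤ y) :
    ∀ᶠ T : ℝ in atTop, |y - ψ y - (zetaZeroSumTrunc y T).re| ≤ 8 + Real.log y / 2 ∧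
      |(zetaZeroSumTrunc y T).im| ≤ 1 := by
  obtain ⟨C, hC⟩ := truncatedExplicitFormula_psi_holds 2 (by norm_num)
  have hy0 : 0 < y := by linarith
  have hy1 : 1 ≤ y := by linarith
  have hd := primePowDist_pos y
  have hlogy : 0 ≤ Real.log y := Real.log_nonneg hy1
  have hev : ∀ᶠ T : ℝ in atTop, max C 0 * (Real.log y * (y / primePowDist y) * T⁻¹ +
      4 * y * (Real.log T ^ 2 / T)) < 1 :=
    (tendsto_truncationError (y := y) C).eventually (gt_mem_nhds one_pos)
  filter_upwards [hev, eventually_ge_atTop (2 : ℝ), eventually_ge_atTop y] with T hT hT2 hTy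
  have hT0 : 0 < T := by linarith
  have h := hC y hy T hT2
  -- upgrade the printed error to the explicit majorant
  have hlogyT : Real.log (y * T) ^ 2 ≤ 4 * Real.log T ^ 2 := by
    have hlt : Real.log y ≤ Real.log T := Real.log_le_log hy0 hTy
    have h0 : 0 ≤ Real.log (y * T) := Real.log_nonneg (by nlinarith)
    rw [Real.log_mul hy0.ne' hT0.ne'] at h0 ⊢
    nlinarith
  have hmaj : C * (Real.log y * min 1 (y / (T * primePowDist y)) + y / T * Real.log (y * T) ^ 2) ≤
      max C 0 * (Real.log y * (y / primePowDist y) * T⁻¹ + 4 * y * (Real.log T ^ 2 / T)) := by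
    have hs0 : 0 ≤ Real.log y * min 1 (y / (T * primePowDist y)) + y / T * Real.log (y * T) ^ 2 :=
      add_nonneg (mul_nonneg hlogy (le_min zero_le_one (by positivity))) (by positivity)
    calc C * (Real.log y * min 1 (y / (T * primePowDist y)) + y / T * Real.log (y * T) ^ 2)
        ≤ max C 0 * (Real.log y * min 1 (y / (T * primePowDist y)) + y / T * Real.log (y * T) ^ 2) :=
          mul_le_mul_of_nonneg_right (le_max_left _ _) hs0
      _ ≤ max C 0 * (Real.log y * (y / primePowDist y) * T⁻¹ + 4 * y * (Real.log T ^ 2 / T)) := by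
          refine mul_le_mul_of_nonneg_left (add_le_add ?_ ?_) (le_max_right _ _)
          · rw [show Real.log y * (y / primePowDist y) * T⁻¹ = Real.log y * (y / (T * primePowDist y)) by
              field_simp]
            exact mul_le_mul_of_nonneg_left (min_le_right _ _) hlogy
          · rw [show 4 * y * (Real.log T ^ 2 / T) = y / T * (4 * Real.log T ^ 2) by ring]
            exact mul_le_mul_of_nonneg_left hlogyT (by positivity)
  have hnorm : ‖(chebyshevPsi₀ y : ℂ) -
      (y - zetaZeroSumTrunc y T - Real.log (2 * π) - 1 / 2 * Real.log (1 - 1 / y ^ 2))‖ < 1 :=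
    (h.trans hmaj).trans_lt hT
  set Z := zetaZeroSumTrunc y T with hZ
  have hexpr : (chebyshevPsi₀ y : ℂ) -
      (y - Z - Real.log (2 * π) - 1 / 2 * Real.log (1 - 1 / y ^ 2)) =
      ((chebyshevPsi₀ y - y + Real.log (2 * π) + 1 / 2 * Real.log (1 - 1 / y ^ 2) : ℝ) : ℂ) + Z := by
    push_cast; ring
  rw [hexpr] at hnorm
  have him : |Z.im| ≤ 1 := by
    have := Complex.abs_im_le_norm
      (((chebyshevPsi₀ y - y + Real.log (2 * π) + 1 / 2 * Real.log (1 - 1 / y ^ 2) : ℝ) : ℂ) + Z)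
    simp only [Complex.add_im, Complex.ofReal_im, zero_add] at this
    linarith
  have hre : |chebyshevPsi₀ y - y + Real.log (2 * π) + 1 / 2 * Real.log (1 - 1 / y ^ 2) + Z.re| ≤ 1 := by
    have := Complex.abs_re_le_norm
      (((chebyshevPsi₀ y - y + Real.log (2 * π) + 1 / 2 * Real.log (1 - 1 / y ^ 2) : ℝ) : ℂ) + Z)
    simp only [Complex.add_re, Complex.ofReal_re] at this
    linarith
  refine ⟨?_, him⟩
  -- constants: `log 2π ≤ 2π − 1 ≤ 6`, `|log(1 − 1/y²)| ≤ 1/3`, `|ψ − ψ₀| ≤ ½ log y`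
  have hL : Real.log (2 * π) ≤ 6 := by
    have := Real.log_le_sub_one_of_pos (show (0 : ℝ) < 2 * π by positivity)
    linarith [Real.pi_lt_d2]
  have hL0 := log_two_pi_nonneg
  have hu0 : 0 < 1 - 1 / y ^ 2 := by
    have : 1 / y ^ 2 ≤ 1 / 4 := by
      rw [div_le_div_iff₀ (by positivity) (by norm_num)]; nlinarith
    linarith
  have hu1 : Real.log (1 - 1 / y ^ 2) ≤ 0 := by
    have : 0 < 1 / y ^ 2 := by positivity
    exact Real.log_nonpos hu0.le (by linarith)
  have hu2 : -(1 / 3) ≤ Real.log (1 - 1 / y ^ 2) := by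
    have h := Real.one_sub_inv_le_log_of_pos hu0
    have : (1 - 1 / y ^ 2)⁻¹ ≤ 4 / 3 := by
      rw [inv_le_comm₀ hu0 (by norm_num)]
      have : 1 / y ^ 2 ≤ 1 / 4 := by
        rw [div_le_div_iff₀ (by positivity) (by norm_num)]; nlinarith
      linarith
    linarith
  have hψ := CramerMeanSquare.abs_psi_sub_chebyshevPsi₀_le hy1
  rw [abs_le] at hψ hre ⊢
  constructor <;> linarith [hψ.1, hψ.2, hre.1, hre.2]

/-- `log y ≤ 2√y` (`y ≥ 0`). [folklore] -/
private theorem log_le_two_mul_sqrt {y : ℝ} (hy : 0 ≤ y) : Real.log y ≤ 2 * Real.sqrt y := by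
  have := Real.log_le_rpow_div hy (show (0 : ℝ) < 1 / 2 by norm_num)
  rw [Real.sqrt_eq_rpow]
  linarith

/-- **Under RH: `D(y) = 2 Re Σ_{|γ|≤T} m(ρ) y^ρ/ρ /√y + O(1)` and `Im Σ → 0`**: there is `K` such that
for every `y ≥ 2`, eventually in `T`,
`|(4√y − 2Π(y)) − 2 Re(zetaZeroSumTrunc y T)/√y| ≤ K` and `|Im zetaZeroSumTrunc y T| ≤ 1`.
[cite: Suzuki2025Chebyshev, §3.2 (3.8) (the zero sum `2Σ_ρ x^{ρ−½}/(ρ−½)` of the cut-off Riesz mean)] -/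
theorem exists_eventually_abs_D_sub_le (hRH : RiemannHypothesis) :
    ∃ K : ℝ, ∀ y : ℝ, 2 ≤ y → ∀ᶠ T : ℝ in atTop,
      |(4 * Real.sqrt y - 2 * ∑ n ∈ Finset.Icc 1 ⌊y⌋₊, Λ n / Real.sqrt n)
          - 2 * (zetaZeroSumTrunc y T).re / Real.sqrt y| ≤ K ∧
        |(zetaZeroSumTrunc y T).im| ≤ 1 := by
  obtain ⟨K, hK⟩ := exists_abs_primeCount_sub_le hRH
  refine ⟨2 * K + 18, fun y hy ↦ ?_⟩
  filter_upwards [eventually_abs_sub_re_zetaZeroSumTrunc_le hy] with T hT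
  refine ⟨?_, hT.2⟩
  have hy1 : 1 ≤ y := by linarith
  have hy0 : 0 < y := by linarith
  set s := Real.sqrt y with hs_def
  have hs1 : 1 ≤ s := by rw [hs_def, ← Real.sqrt_one]; exact Real.sqrt_le_sqrt hy1
  have hs0 : 0 < s := by linarith
  have hys : y / s = s := by
    rw [div_eq_iff hs0.ne', hs_def]; exact (Real.mul_self_sqrt hy0.le).symm
  set P := ∑ n ∈ Finset.Icc 1 ⌊y⌋₊, Λ n / Real.sqrt n
  set R := (zetaZeroSumTrunc y T).re
  have h1 := hK y hy1
  have h2 := hT.1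
  have hid : (4 * s - 2 * P) - 2 * R / s = -2 * (P - ψ y / s - s) + 2 * (y - ψ y - R) / s := by
    have : 2 * (y - ψ y - R) / s = 2 * (y / s) - 2 * (ψ y / s) - 2 * R / s := by ring
    rw [this, hys]; ring
  rw [hid]
  have h3 : |2 * (y - ψ y - R) / s| ≤ 18 := by
    rw [abs_div, abs_of_pos hs0, abs_mul, abs_two, div_le_iff₀ hs0]
    have hlog := log_le_two_mul_sqrt hy0.le
    rw [← hs_def] at hlog
    nlinarith [h2, Real.log_nonneg hy1]
  calc |-2 * (P - ψ y / s - s) + 2 * (y - ψ y - R) / s|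
      ≤ |-2 * (P - ψ y / s - s)| + |2 * (y - ψ y - R) / s| := abs_add_le _ _
    _ ≤ 2 * K + 18 := by
        rw [abs_mul, abs_neg, abs_two]
        linarith [mul_le_mul_of_nonneg_left h1 (show (0:ℝ) ≤ 2 by norm_num)]


/-! ### §4 The cut-off Riesz mean against `D(y)` and `Ψ`; Landau's theorem for (1.11) ⟹ RH -/

/-- **(1.7) + (1.9)** in the variable `y ≥ 1`:
`Σ_{n ≤ y} Λ(n) n^{-1/2} log(y/n) − 4√y = 4/√y − 8 − Ψ(log y) − (κ/2) log y + ¼(C₀ − e^{−log y/2}Φ(log y))`,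
`κ = γ + π/2 + 3 log 2 + log π`, `C₀ = Σ_{k ≥ 0}(k + 1/4)^{-2}`.
[cite: Suzuki2025Chebyshev, §1.1 eq. (1.7) and (1.9)] -/
theorem primeSum_log_sub_eq {y : ℝ} (hy : 1 ≤ y) :
    ∑ n ∈ Finset.Icc 1 ⌊y⌋₊, Λ n / Real.sqrt n * Real.log (y / n) - 4 * Real.sqrt y =
      4 / Real.sqrt y - 8 - zetaScrew (Real.log y)
        - Real.log y / 2 *
            (Real.eulerMascheroniConstant + Real.pi / 2 + 3 * Real.log 2 + Real.log Real.pi)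
        + (1 / 4) * ((∑' k : ℕ, 1 / ((k : ℝ) + 1 / 4) ^ 2)
            - Real.exp (-(Real.log y / 2)) * hurwitzLerchQuarter (Real.log y)) := by
  have hN := zetaScrewNonArch_log hy
  have hΨ := zetaScrew_eq_zetaScrewNonArch_sub_add (Real.log y)
  rw [abs_of_nonneg (Real.log_nonneg hy)] at hΨ
  linear_combination hN + hΨ

/-- The bounded archimedean piece: `|4/√y − 8 + ¼(C₀ − e^{−log y/2}Φ(log y))| ≤ 12 + C₀/4` (`y ≥ 1`;
`0 ≤ e^{−t/2}Φ_t ≤ Φ_t ≤ C₀`). [cite: Suzuki2025Chebyshev, §3.1 (proof of Thm 1)] -/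
theorem abs_screwConst_le {y : ℝ} (hy : 1 ≤ y) :
    |4 / Real.sqrt y - 8 + (1 / 4) * ((∑' k : ℕ, 1 / ((k : ℝ) + 1 / 4) ^ 2)
        - Real.exp (-(Real.log y / 2)) * hurwitzLerchQuarter (Real.log y))|
      ≤ 12 + (∑' k : ℕ, 1 / ((k : ℝ) + 1 / 4) ^ 2) / 4 := by
  have hC0 : 0 ≤ ∑' k : ℕ, 1 / ((k : ℝ) + 1 / 4) ^ 2 := tsum_nonneg fun k ↦ by positivity
  have hs1 : 1 ≤ Real.sqrt y := by rw [← Real.sqrt_one]; exact Real.sqrt_le_sqrt hy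
  have hs0 : 0 < Real.sqrt y := by linarith
  have h1 : 4 / Real.sqrt y ≤ 4 := by rw [div_le_iff₀ hs0]; nlinarith
  have h1' : 0 ≤ 4 / Real.sqrt y := by positivity
  have hΦ0 := hurwitzLerchQuarter_nonneg (Real.log y)
  have hΦC := hurwitzLerchQuarter_le (Real.log y)
  have hE1 : Real.exp (-(Real.log y / 2)) ≤ 1 := by
    rw [Real.exp_le_one_iff]; linarith [Real.log_nonneg hy]
  have h3 : 0 ≤ Real.exp (-(Real.log y / 2)) * hurwitzLerchQuarter (Real.log y) :=
    mul_nonneg (Real.exp_pos _).le hΦ0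
  have h4 : Real.exp (-(Real.log y / 2)) * hurwitzLerchQuarter (Real.log y) ≤
      ∑' k : ℕ, 1 / ((k : ℝ) + 1 / 4) ^ 2 :=
    le_trans (mul_le_of_le_one_left hΦ0 hE1) hΦC
  rw [abs_le]
  constructor <;> linarith

/-- `F(x)·log x = Σ_{n ≤ xe²} Λ(n) n^{-1/2} log(x/n)` for the cut-off Riesz mean
`F(x) = Σ_{n ≤ xe²} Λ(n) n^{-1/2}(1 − log n/log x)` (`x > 1`). [cite: Suzuki2025Chebyshev, §1.1 (1.10)–(1.11)] -/
theorem rieszCutoff_mul_log {x : ℝ} (hx : 1 < x) :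
    (∑ n ∈ Finset.Icc 1 ⌊x * Real.exp 2⌋₊, Λ n / Real.sqrt n * (1 - Real.log n / Real.log x)) *
        Real.log x =
      ∑ n ∈ Finset.Icc 1 ⌊x * Real.exp 2⌋₊, Λ n / Real.sqrt n * Real.log (x / n) := by
  have hx0 : 0 < x := by linarith
  have hL : 0 < Real.log x := Real.log_pos hx
  rw [Finset.sum_mul]
  refine Finset.sum_congr rfl fun n hn ↦ ?_
  have hn1 : 1 ≤ n := (Finset.mem_Icc.1 hn).1
  rw [Real.log_div hx0.ne' (by exact_mod_cast (show n ≠ 0 by omega))]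
  field_simp

/-- **The cut-off Riesz mean through `D` and `Ψ`**: for `x > 1`, with `y = xe²`,
`κ = γ + π/2 + 3 log 2 + log π` and `Π(y) = Σ_{n ≤ y} Λ(n) n^{-1/2}`,
`(F(x) + κ/2)·log x = (4√y − 2Π(y)) − Ψ(log y) + [4/√y − 8 − κ + ¼(C₀ − e^{−log y/2}Φ(log y))]`.
[cite: Suzuki2025Chebyshev, §1.1 eq. (1.7), (1.9), (1.11)] -/
theorem rieszCutoff_identity {x : ℝ} (hx : 1 < x) :
    (∑ n ∈ Finset.Icc 1 ⌊x * Real.exp 2⌋₊, Λ n / Real.sqrt n * (1 - Real.log n / Real.log x)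
        + (Real.eulerMascheroniConstant + Real.pi / 2 + 3 * Real.log 2 + Real.log Real.pi) / 2) *
        Real.log x =
      (4 * Real.sqrt (x * Real.exp 2) - 2 * ∑ n ∈ Finset.Icc 1 ⌊x * Real.exp 2⌋₊, Λ n / Real.sqrt n)
        - zetaScrew (Real.log (x * Real.exp 2))
        + (4 / Real.sqrt (x * Real.exp 2) - 8
            - (Real.eulerMascheroniConstant + Real.pi / 2 + 3 * Real.log 2 + Real.log Real.pi)
            + (1 / 4) * ((∑' k : ℕ, 1 / ((k : ℝ) + 1 / 4) ^ 2)
              - Real.exp (-(Real.log (x * Real.exp 2) / 2)) *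
                  hurwitzLerchQuarter (Real.log (x * Real.exp 2)))) := by
  have hx0 : 0 < x := by linarith
  have hL : 0 < Real.log x := Real.log_pos hx
  set y := x * Real.exp 2 with hy_def
  have he2 : 1 ≤ Real.exp 2 := Real.one_le_exp (by norm_num)
  have hy1 : 1 ≤ y := by nlinarith
  have hy0 : 0 < y := by linarith
  have hlogy : Real.log y = Real.log x + 2 := by
    rw [hy_def, Real.log_mul hx0.ne' (Real.exp_pos 2).ne', Real.log_exp]
  have hsum : (∑ n ∈ Finset.Icc 1 ⌊y⌋₊, Λ n / Real.sqrt n * (1 - Real.log n / Real.log x)) *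
      Real.log x =
      ∑ n ∈ Finset.Icc 1 ⌊y⌋₊, Λ n / Real.sqrt n * Real.log (y / n) -
        2 * ∑ n ∈ Finset.Icc 1 ⌊y⌋₊, Λ n / Real.sqrt n := by
    rw [Finset.sum_mul, Finset.mul_sum, ← Finset.sum_sub_distrib]
    refine Finset.sum_congr rfl fun n hn ↦ ?_
    have hn1 : 1 ≤ n := (Finset.mem_Icc.1 hn).1
    rw [Real.log_div hy0.ne' (by exact_mod_cast (show n ≠ 0 by omega)), hlogy]
    field_simp
    ring
  have hid := primeSum_log_sub_eq hy1
  rw [add_mul, hsum]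
  linear_combination hid -
    ((Real.eulerMascheroniConstant + Real.pi / 2 + 3 * Real.log 2 + Real.log Real.pi) / 2) * hlogy

/-- **Landau's theorem for the cut-off sum with a logarithmic allowance**: if
`Σ_{n ≤ xe²} Λ(n) n^{-1/2} log(x/n) ≤ B log x` for all `x ≥ x₁` (`x₁ ≥ 1`), then RH. In `t = log x + 2`
this says `φ(t) − 2Π(t) ≤ B(t − 2)`, so `G = 2Π − φ + B⁺t ≥ 0` beyond `log x₁ + 2`, with Laplace
transform `((1 − 2S)ζ₁'/ζ₁(½+S) + 2 + B⁺)/S²` (`HalfLinePrimeSumLandau.laplace_two_primeCount_sub_primeSum`,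
`ZetaScrewLaplace.integral_ofReal_mul_cexp`); the tree's engine
`HalfLinePrimeSumLandau.riemannHypothesis_of_laplace_eq_mul` applies (`1 − 2S ≠ 0` on `Re S < ½`).
[cite: Suzuki2025Chebyshev, §3.2 with §2 Prop 1 (proof of Thm 2, «f ≪ log x» variant as in §5.1)] -/
theorem riemannHypothesis_of_rieszCutoff_le {B x₁ : ℝ} (hx₁ : 1 ≤ x₁)
    (hB : ∀ x : ℝ, x₁ ≤ x →
      ∑ n ∈ Finset.Icc 1 ⌊x * Real.exp 2⌋₊, Λ n / Real.sqrt n * Real.log (x / n) ≤ B * Real.log x) :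
    RiemannHypothesis := by
  set B' := max B 0 with hB'
  have hB'0 : 0 ≤ B' := le_max_right _ _
  have hx₁0 : 0 < x₁ := by linarith
  set G : ℝ → ℝ := fun t ↦
    2 * (∑ n ∈ Finset.Icc 1 ⌊Real.exp t⌋₊, Λ n / Real.sqrt n) - zetaScrewPrimeSum t + B' * t
    with hG_def
  have hmono : Monotone fun t : ℝ ↦ ∑ n ∈ Finset.Icc 1 ⌊Real.exp t⌋₊, Λ n / Real.sqrt n := by
    intro t u htu
    refine Finset.sum_le_sum_of_subset_of_nonneg
      (Finset.Icc_subset_Icc_right (Nat.floor_mono (Real.exp_le_exp.2 htu))) fun _ _ _ ↦ ?_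
    exact div_nonneg ArithmeticFunction.vonMangoldt_nonneg (Real.sqrt_nonneg _)
  have hGm : Measurable G :=
    ((hmono.measurable.const_mul 2).sub continuous_zetaScrewPrimeSum.measurable).add
      (measurable_const.mul measurable_id)
  refine HalfLinePrimeSumLandau.riemannHypothesis_of_laplace_eq_mul (G := G) hGm
    (t₀ := Real.log x₁ + 2) (fun t ht ↦ ?_) ?_ (c := fun s ↦ 1 - 2 * s) (P := fun _ ↦ 2 + (B' : ℂ))
    (by fun_prop) (fun s _ hs' hcs ↦ ?_) (by fun_prop) (fun s hs ↦ ?_)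
  · -- non-negativity beyond `log x₁ + 2`, from the hypothesis at `x = e^{t−2}`
    have hlog0 : 0 ≤ Real.log x₁ := Real.log_nonneg hx₁
    have ht0 : 0 ≤ t := by linarith
    set x : ℝ := Real.exp (t - 2) with hx_def
    have hx₁x : x₁ ≤ x := by
      rw [hx_def, ← Real.exp_log hx₁0]; exact Real.exp_le_exp.2 (by linarith)
    have hx0 : 0 < x := Real.exp_pos _
    have hxe : x * Real.exp 2 = Real.exp t := by
      rw [hx_def, ← Real.exp_add]; congr 1; ring
    have hlogx : Real.log x = t - 2 := by rw [hx_def, Real.log_exp]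
    have hyp := hB x hx₁x
    rw [hxe, hlogx] at hyp
    have hyp' : ∑ n ∈ Finset.Icc 1 ⌊Real.exp t⌋₊, Λ n / Real.sqrt n * Real.log (x / n) ≤ B' * t := by
      refine hyp.trans ?_
      calc B * (t - 2) ≤ B' * (t - 2) := mul_le_mul_of_nonneg_right (le_max_left _ _) (by linarith)
        _ ≤ B' * t := by nlinarith
    have hG : G t = -(∑ n ∈ Finset.Icc 1 ⌊Real.exp t⌋₊, Λ n / Real.sqrt n * Real.log (x / n))
        + B' * t := by
      simp only [hG_def, zetaScrewPrimeSum, abs_of_nonneg ht0]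
      rw [Finset.mul_sum, ← Finset.sum_sub_distrib, ← Finset.sum_neg_distrib]
      congr 1
      refine Finset.sum_congr rfl fun n hn ↦ ?_
      rw [Finset.mem_Icc] at hn
      have hn0 : (n : ℝ) ≠ 0 := by exact_mod_cast (show n ≠ 0 by omega)
      rw [Real.log_div hx0.ne' hn0, hlogx]
      ring
    rw [hG]; linarith
  · -- integrability of `G(t) e^{−t}`
    have h1 := (HalfLinePrimeSumLandau.integral_primeCount_mul_cexp (a := -1) (by norm_num)).1
    have h2 := (ZetaScrewLaplace.integral_primeSum_mul_cexp (a := -1) (by norm_num)).1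
    have h3 := ZetaScrewLaplace.integrableOn_ofReal_mul_cexp (a := -1) (by norm_num)
    have h : IntegrableOn (fun t : ℝ ↦
        2 * (((∑ n ∈ Finset.Icc 1 ⌊Real.exp t⌋₊, Λ n / Real.sqrt n : ℝ) : ℂ) * cexp (-1 * t))
          - (zetaScrewPrimeSum t : ℂ) * cexp (-1 * t) + (B' : ℂ) * ((t : ℂ) * cexp (-1 * t))) (Ioi 0) :=
      ((h1.const_mul 2).sub h2).add (h3.const_mul (B' : ℂ))
    refine h.congr_fun (fun t _ ↦ ?_) measurableSet_Ioi
    simp only [hG_def]; push_cast; ring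
  · -- `c(S) = 1 − 2S ≠ 0` for `Re S < 1/2`
    have := congrArg Complex.re (sub_eq_zero.1 hcs)
    simp at this; linarith
  · -- the transform
    have hs' : (-s).re < 0 := by simp; linarith
    obtain ⟨hi, hI⟩ := HalfLinePrimeSumLandau.laplace_two_primeCount_sub_primeSum hs
    have h3 := ZetaScrewLaplace.integrableOn_ofReal_mul_cexp hs'
    have hI3 := ZetaScrewLaplace.integral_ofReal_mul_cexp hs'
    have heq : EqOn (fun t : ℝ ↦ (G t : ℂ) * cexp (-s * t))
        (fun t ↦ ((2 * (∑ n ∈ Finset.Icc 1 ⌊Real.exp t⌋₊, Λ n / Real.sqrt n)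
            - zetaScrewPrimeSum t : ℝ) : ℂ) * cexp (-s * t)
          + (B' : ℂ) * ((t : ℂ) * cexp (-s * t))) (Ioi 0) := by
      intro t _; simp only [hG_def]; push_cast; ring
    rw [setIntegral_congr_fun measurableSet_Ioi heq, integral_add hi (h3.const_mul _),
      integral_const_mul, hI, hI3]
    have hs0 : s ≠ 0 := fun h ↦ by rw [h, zero_re] at hs; linarith
    field_simp
    ring

/-- **(1.11) ⟹ RH**: if the cut-off Riesz mean `F(x)` converges (to anything), then
`Σ_{n ≤ xe²} Λ(n) n^{-1/2} log(x/n) = F(x) log x ≤ (|L| + 1) log x` eventually, and Landau's theorem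
gives RH. [cite: Suzuki2025Chebyshev, Thm 2 (second assertion, direction ⟹) with §3.2] -/
theorem riemannHypothesis_of_tendsto_rieszCutoff {L : ℝ}
    (h : Tendsto (fun x : ℝ ↦ ∑ n ∈ Finset.Icc 1 ⌊x * Real.exp 2⌋₊,
      Λ n / Real.sqrt n * (1 - Real.log n / Real.log x)) atTop (𝓝 L)) :
    RiemannHypothesis := by
  have hev := (Metric.tendsto_nhds.1 h) 1 one_pos
  obtain ⟨x₁, hx₁⟩ := eventually_atTop.1 (hev.and (eventually_ge_atTop (2 : ℝ)))
  have hx₁2 : 2 ≤ x₁ := (hx₁ x₁ le_rfl).2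
  refine riemannHypothesis_of_rieszCutoff_le (B := |L| + 1) (x₁ := x₁) (by linarith) fun x hx ↦ ?_
  obtain ⟨hF, hx2⟩ := hx₁ x hx
  have hx1 : 1 < x := by linarith
  rw [← rieszCutoff_mul_log hx1]
  refine mul_le_mul_of_nonneg_right ?_ (Real.log_pos hx1).le
  rw [Real.dist_eq] at hF
  have := abs_sub_abs_le_abs_sub
    (∑ n ∈ Finset.Icc 1 ⌊x * Real.exp 2⌋₊, Λ n / Real.sqrt n * (1 - Real.log n / Real.log x)) L
  linarith [le_abs_self
    (∑ n ∈ Finset.Icc 1 ⌊x * Real.exp 2⌋₊, Λ n / Real.sqrt n * (1 - Real.log n / Real.log x))]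

/-! ### §5 Theorem 2, second assertion: (1.11) ⟺ RH ∧ (1.12) -/

/-- **(⟸) Under RH and (1.12), `F(x) → −κ/2`.** With `y = xe²`: `(F(x) + κ/2) log x = D(y) − Ψ(log y) + O(1)`,
`|Ψ| ≤ M` (Suzuki 2023 Thm 1.6), `|D(y) − 2ReΣ_T(y)/√y| ≤ K` eventually in `T` (§3), and (1.12) makes
`2|ReΣ_T(y)|/√y ≤ (ε/4) log y` eventually. [cite: Suzuki2025Chebyshev, Thm 2 (second assertion, ⟸) with §3.2] -/
theorem tendsto_rieszCutoff_of_RH (hRH : RiemannHypothesis)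
    (h12 : ∀ ε : ℝ, 0 < ε → ∀ᶠ x : ℝ in atTop, ∀ᶠ T : ℝ in atTop,
      ‖zetaZeroSumTrunc x T‖ ≤ ε * (Real.sqrt x * Real.log x)) :
    Tendsto (fun x : ℝ ↦ ∑ n ∈ Finset.Icc 1 ⌊x * Real.exp 2⌋₊,
        Λ n / Real.sqrt n * (1 - Real.log n / Real.log x)) atTop
      (𝓝 (-((Real.eulerMascheroniConstant + Real.pi / 2 + 3 * Real.log 2 + Real.log Real.pi) / 2))) := by
  have hκ0 := screwKappa_pos
  obtain ⟨M, hM⟩ := ZetaScrewGrowth.riemannHypothesis_iff_zetaScrew_bounded.1 hRH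
  obtain ⟨K, hK⟩ := exists_eventually_abs_D_sub_le hRH
  rw [Metric.tendsto_nhds]
  intro ε hε
  have hT : Tendsto (fun x : ℝ ↦ x * Real.exp 2) atTop atTop :=
    tendsto_id.atTop_mul_const (Real.exp_pos 2)
  have h12y : ∀ᶠ x : ℝ in atTop, ∀ᶠ T : ℝ in atTop,
      ‖zetaZeroSumTrunc (x * Real.exp 2) T‖ ≤
        ε / 8 * (Real.sqrt (x * Real.exp 2) * Real.log (x * Real.exp 2)) :=
    hT.eventually (h12 (ε / 8) (by positivity))
  -- the constant to be absorbed by `log x`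
  obtain ⟨A, hA⟩ : ∃ A : ℝ, A = K + M + (12 +
      (Real.eulerMascheroniConstant + Real.pi / 2 + 3 * Real.log 2 + Real.log Real.pi) +
      (∑' k : ℕ, 1 / ((k : ℝ) + 1 / 4) ^ 2) / 4) + ε := ⟨_, rfl⟩
  filter_upwards [h12y, eventually_ge_atTop (2 : ℝ), eventually_ge_atTop (Real.exp (4 * A / ε))]
    with x hx hx2 hxA
  have hx1 : 1 < x := by linarith
  have hx0 : 0 < x := by linarith
  have hL : 0 < Real.log x := Real.log_pos hx1
  have hLA : 4 * A / ε ≤ Real.log x := by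
    rw [Real.le_log_iff_exp_le hx0]; exact hxA
  have hLA' : A ≤ ε / 4 * Real.log x := by
    have := mul_le_mul_of_nonneg_left hLA (show 0 ≤ ε / 4 by positivity)
    calc A = ε / 4 * (4 * A / ε) := by field_simp
      _ ≤ ε / 4 * Real.log x := this
  have he2 : 1 ≤ Real.exp 2 := Real.one_le_exp (by norm_num)
  have hy2 : 2 ≤ x * Real.exp 2 := by nlinarith
  have hy1 : 1 ≤ x * Real.exp 2 := by linarith
  have hlogy : Real.log (x * Real.exp 2) = Real.log x + 2 := by
    rw [Real.log_mul hx0.ne' (Real.exp_pos 2).ne', Real.log_exp]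
  obtain ⟨T, hT1, hT2⟩ := (hx.and (hK _ hy2)).exists
  -- the identity and the bounded pieces, all at `y = xe²`
  have hid := rieszCutoff_identity hx1
  have hQ := abs_screwConst_le hy1
  have hΨ := hM (Real.log (x * Real.exp 2)) (Real.log_nonneg hy1)
  -- abbreviations (everything above is now rewritten consistently)
  set y := x * Real.exp 2 with hy_def
  set κ := Real.eulerMascheroniConstant + Real.pi / 2 + 3 * Real.log 2 + Real.log Real.pi with hκ
  set C₀ := ∑' k : ℕ, 1 / ((k : ℝ) + 1 / 4) ^ 2 with hC₀
  set P := ∑ n ∈ Finset.Icc 1 ⌊y⌋₊, Λ n / Real.sqrt n with hP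
  set Z := zetaZeroSumTrunc y T with hZ
  set Φ := Real.exp (-(Real.log y / 2)) * hurwitzLerchQuarter (Real.log y) with hΦ
  set F := ∑ n ∈ Finset.Icc 1 ⌊y⌋₊, Λ n / Real.sqrt n * (1 - Real.log n / Real.log x) with hF
  have hy0 : 0 < y := by linarith
  have hsy : 0 < Real.sqrt y := Real.sqrt_pos.2 hy0
  -- `|2 Re Z/√y| ≤ (ε/4) log y`
  have hReZ : |2 * Z.re / Real.sqrt y| ≤ ε / 4 * Real.log y := by
    rw [abs_div, abs_of_pos hsy, div_le_iff₀ hsy, abs_mul, abs_two]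
    have h1 := (Complex.abs_re_le_norm Z).trans hT1
    have h2 : ε / 8 * (Real.sqrt y * Real.log y) = (ε / 8 * Real.log y) * Real.sqrt y := by ring
    rw [h2] at h1
    calc 2 * |Z.re| ≤ 2 * ((ε / 8 * Real.log y) * Real.sqrt y) := by linarith
      _ = ε / 4 * Real.log y * Real.sqrt y := by ring
  -- `|D(y)| ≤ K + (ε/4) log y`
  have hD : |4 * Real.sqrt y - 2 * P| ≤ K + ε / 4 * Real.log y := by
    have h1 := hT2.1
    have htri := abs_add_le (4 * Real.sqrt y - 2 * P - 2 * Z.re / Real.sqrt y) (2 * Z.re / Real.sqrt y)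
    rw [sub_add_cancel] at htri
    linarith
  -- `|(F + κ/2) log x| ≤ A + (ε/4) log x`
  have hbound : |(F + κ / 2) * Real.log x| ≤ A + ε / 4 * Real.log x := by
    rw [hid, hlogy] at *
    rw [hlogy] at hD
    rw [abs_le] at hD hQ hΨ ⊢
    obtain ⟨hD1, hD2⟩ := hD
    obtain ⟨hQ1, hQ2⟩ := hQ
    obtain ⟨hΨ1, hΨ2⟩ := hΨ
    constructor <;> linarith
  rw [Real.dist_eq, sub_neg_eq_add]
  have hfin : |F + κ / 2| * Real.log x ≤ (ε / 2) * Real.log x := by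
    rw [← abs_of_pos hL, ← abs_mul, abs_of_pos hL]
    linarith
  have := le_of_mul_le_mul_right hfin hL
  linarith

/-- **(⟹, second half) Under RH, (1.11) implies (1.12)**: `|D(y)| ≤ ε log y + O(1)` from (1.11) and
the identity of §4, so `2|ReΣ_T(y)|/√y ≤ ε log y + O(1)` and `|ImΣ_T(y)| ≤ 1` eventually in `T` (§3),
whence `‖Σ_T(y)‖ ≤ ε' √y log y` for large `y`. [cite: Suzuki2025Chebyshev, Thm 2 (second assertion, ⟹) with §3.2] -/
theorem zetaZeroSumTrunc_isLittleO_of_tendsto_rieszCutoff (hRH : RiemannHypothesis)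
    (h : Tendsto (fun x : ℝ ↦ ∑ n ∈ Finset.Icc 1 ⌊x * Real.exp 2⌋₊,
        Λ n / Real.sqrt n * (1 - Real.log n / Real.log x)) atTop
      (𝓝 (-((Real.eulerMascheroniConstant + Real.pi / 2 + 3 * Real.log 2 + Real.log Real.pi) / 2)))) :
    ∀ ε : ℝ, 0 < ε → ∀ᶠ x : ℝ in atTop, ∀ᶠ T : ℝ in atTop,
      ‖zetaZeroSumTrunc x T‖ ≤ ε * (Real.sqrt x * Real.log x) := by
  have hκ0 := screwKappa_pos
  obtain ⟨M, hM⟩ := ZetaScrewGrowth.riemannHypothesis_iff_zetaScrew_bounded.1 hRH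
  obtain ⟨K, hK⟩ := exists_eventually_abs_D_sub_le hRH
  intro ε hε
  have hev := (Metric.tendsto_nhds.1 h) (ε / 4) (by positivity)
  obtain ⟨x₂, hx₂⟩ := eventually_atTop.1 (hev.and (eventually_gt_atTop (1 : ℝ)))
  obtain ⟨B₀, hB₀⟩ : ∃ B₀ : ℝ, B₀ = K + M + (12 +
      (Real.eulerMascheroniConstant + Real.pi / 2 + 3 * Real.log 2 + Real.log Real.pi) +
      (∑' k : ℕ, 1 / ((k : ℝ) + 1 / 4) ^ 2) / 4) := ⟨_, rfl⟩
  filter_upwards [eventually_ge_atTop (x₂ * Real.exp 2), eventually_ge_atTop (2 : ℝ),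
    eventually_ge_atTop (Real.exp ((B₀ + 2) / ε))] with y hy hy2 hyB
  have hy1 : 1 ≤ y := by linarith
  have hy0 : 0 < y := by linarith
  have hxy : y / Real.exp 2 * Real.exp 2 = y := div_mul_cancel₀ _ (Real.exp_pos 2).ne'
  have hx₂x : x₂ ≤ y / Real.exp 2 := by rw [le_div_iff₀ (Real.exp_pos 2)]; exact hy
  obtain ⟨hFx, hx1⟩ := hx₂ (y / Real.exp 2) hx₂x
  have hx0 : 0 < y / Real.exp 2 := by linarith
  have hL : 0 < Real.log (y / Real.exp 2) := Real.log_pos hx1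
  have hlogy : Real.log y = Real.log (y / Real.exp 2) + 2 := by
    rw [Real.log_div hy0.ne' (Real.exp_pos 2).ne', Real.log_exp]; ring
  have hlogB : (B₀ + 2) / ε ≤ Real.log y := by
    rw [Real.le_log_iff_exp_le hy0]; exact hyB
  have hlogB' : B₀ + 2 ≤ ε * Real.log y := by
    have := mul_le_mul_of_nonneg_left hlogB hε.le
    calc B₀ + 2 = ε * ((B₀ + 2) / ε) := by field_simp
      _ ≤ ε * Real.log y := this
  -- the identity at `x = y/e²`, and the bounded pieces
  have hid := rieszCutoff_identity hx1
  rw [hxy] at hid hFx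
  have hQ := abs_screwConst_le hy1
  have hΨ := hM (Real.log y) (Real.log_nonneg hy1)
  filter_upwards [hK y hy2] with T hT
  have hsy : 0 < Real.sqrt y := Real.sqrt_pos.2 hy0
  have hs1 : 1 ≤ Real.sqrt y := by rw [← Real.sqrt_one]; exact Real.sqrt_le_sqrt hy1
  obtain ⟨hT1, hIm⟩ := hT
  -- abbreviations
  set x := y / Real.exp 2 with hx_def
  set κ := Real.eulerMascheroniConstant + Real.pi / 2 + 3 * Real.log 2 + Real.log Real.pi with hκ
  set C₀ := ∑' k : ℕ, 1 / ((k : ℝ) + 1 / 4) ^ 2 with hC₀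
  set P := ∑ n ∈ Finset.Icc 1 ⌊y⌋₊, Λ n / Real.sqrt n with hP
  set Z := zetaZeroSumTrunc y T with hZ
  set Φ := Real.exp (-(Real.log y / 2)) * hurwitzLerchQuarter (Real.log y) with hΦ
  set F := ∑ n ∈ Finset.Icc 1 ⌊y⌋₊, Λ n / Real.sqrt n * (1 - Real.log n / Real.log x) with hF
  rw [Real.dist_eq, sub_neg_eq_add] at hFx
  have hFx' : |(F + κ / 2) * Real.log x| ≤ ε / 4 * Real.log x := by
    rw [abs_mul, abs_of_pos hL]
    exact mul_le_mul_of_nonneg_right hFx.le hL.le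
  -- `|D(y)| ≤ (ε/4) log x + M + (12 + κ + C₀/4)`
  have hD : |4 * Real.sqrt y - 2 * P| ≤ ε / 4 * Real.log x + M + (12 + κ + C₀ / 4) := by
    rw [hid] at hFx'
    rw [abs_le] at hFx' hQ hΨ ⊢
    obtain ⟨h1, h2⟩ := hFx'
    obtain ⟨hQ1, hQ2⟩ := hQ
    obtain ⟨hΨ1, hΨ2⟩ := hΨ
    constructor <;> linarith
  -- `2|Re Z| ≤ √y (|D| + K)`
  have hRe : 2 * |Z.re| ≤ Real.sqrt y * (ε / 4 * Real.log y + B₀) := by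
    have htri := abs_add_le (-(4 * Real.sqrt y - 2 * P - 2 * Z.re / Real.sqrt y))
      (4 * Real.sqrt y - 2 * P)
    rw [abs_neg, show -(4 * Real.sqrt y - 2 * P - 2 * Z.re / Real.sqrt y) +
      (4 * Real.sqrt y - 2 * P) = 2 * Z.re / Real.sqrt y by ring, abs_div, abs_of_pos hsy,
      abs_mul, abs_two, div_le_iff₀ hsy] at htri
    have hlx : Real.log x ≤ Real.log y := by rw [hlogy]; linarith
    have h3 : |4 * Real.sqrt y - 2 * P - 2 * Z.re / Real.sqrt y| + |4 * Real.sqrt y - 2 * P| ≤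
        ε / 4 * Real.log y + B₀ := by
      have : ε / 4 * Real.log x ≤ ε / 4 * Real.log y :=
        mul_le_mul_of_nonneg_left hlx (by positivity)
      linarith
    calc 2 * |Z.re| ≤ (|4 * Real.sqrt y - 2 * P - 2 * Z.re / Real.sqrt y| +
        |4 * Real.sqrt y - 2 * P|) * Real.sqrt y := htri
      _ ≤ (ε / 4 * Real.log y + B₀) * Real.sqrt y := mul_le_mul_of_nonneg_right h3 hsy.le
      _ = Real.sqrt y * (ε / 4 * Real.log y + B₀) := mul_comm _ _
  have hlog0 : 0 ≤ Real.log y := Real.log_nonneg hy1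
  -- assemble: `‖Z‖ ≤ |Re Z| + |Im Z| ≤ (ε/8)√y log y + (B₀/2)√y + 1 ≤ ε √y log y`
  have hB1 : B₀ / 2 * Real.sqrt y + 1 ≤ (B₀ / 2 + 1) * Real.sqrt y := by nlinarith
  have hB2 : (B₀ / 2 + 1) * Real.sqrt y ≤ (ε / 2 * Real.log y) * Real.sqrt y :=
    mul_le_mul_of_nonneg_right (by linarith) hsy.le
  calc ‖Z‖ ≤ |Z.re| + |Z.im| := Complex.norm_le_abs_re_add_abs_im Z
    _ ≤ Real.sqrt y * (ε / 4 * Real.log y + B₀) / 2 + 1 := by linarith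
    _ = (ε / 8 * Real.log y) * Real.sqrt y + (B₀ / 2 * Real.sqrt y + 1) := by ring
    _ ≤ (ε / 8 * Real.log y) * Real.sqrt y + (ε / 2 * Real.log y) * Real.sqrt y := by linarith
    _ ≤ ε * (Real.sqrt y * Real.log y) := by
        have : 0 ≤ ε * (Real.sqrt y * Real.log y) := by positivity
        linarith

end ChebyshevHalfLineBiasThm2

/-! ### §5 (end) The discharge of `Suzuki2025Chebyshev_thm2_iff` -/

open ChebyshevHalfLineBiasThm2 in
/-- **Suzuki 2025, Theorem 2 (second assertion)** — discharge of the named fact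
`Suzuki2025Chebyshev_thm2_iff`: `lim_{x→∞} Σ_{n ≤ xe²} Λ(n) n^{-1/2}(1 − log n/log x) = −(ζ'/ζ)(1/2)`
if and only if RH holds and `Σ_ρ x^ρ/ρ = o(√x log x)` (the latter encoded, as in the fact, with the
tree's truncated zero sum `zetaZeroSumTrunc`). ⟹: Landau (§4) gives RH, then §3–§4 give (1.12);
⟸: §3–§4. `−(ζ'/ζ)(1/2) = −κ/2` by `logDeriv_riemannZeta_one_half`. RH-EQUIVALENT-type criterion
(an equivalence with `RH ∧ (1.12)`, «a condition stronger than the RH»); RH-FREE proof.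
[cite: Suzuki2025Chebyshev, §1.1 Thm 2 (second assertion); proof §3.2] -/
theorem Suzuki2025Chebyshev_thm2_iff_holds : Suzuki2025Chebyshev_thm2_iff := by
  unfold Suzuki2025Chebyshev_thm2_iff
  rw [logDeriv_riemannZeta_one_half, Complex.ofReal_re]
  constructor
  · intro h
    have hRH := riemannHypothesis_of_tendsto_rieszCutoff h
    exact ⟨hRH, zetaZeroSumTrunc_isLittleO_of_tendsto_rieszCutoff hRH h⟩
  · rintro ⟨hRH, h12⟩
    exact tendsto_rieszCutoff_of_RH hRH h12

/-! ### §6 Theorem 5, second assertion -/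

namespace ChebyshevHalfLineBiasThm2

/-- **The non-prime prime powers beyond `x` cost `O(1)`**: for `x ≥ 1`,
`Σ_{n ≤ xe², n not prime} Λ(n) n^{-1/2} log(x/n) ≥ −2(ψ(xe²) − ϑ(xe²))/√x` (terms with `n ≤ x` are
`≥ 0`; for `x < n ≤ xe²`, `log(x/n) ≥ −2` and `n^{-1/2} ≤ x^{-1/2}`).
[cite: Suzuki2025Chebyshev, §4.3 (proof of Thm 5: the passage from all prime powers to primes)] -/
theorem sum_nonPrime_ge {x : ℝ} (hx : 1 ≤ x) :
    -(2 * (ψ (x * Real.exp 2) - θ (x * Real.exp 2)) / Real.sqrt x) ≤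
      ∑ n ∈ (Finset.Icc 1 ⌊x * Real.exp 2⌋₊).filter (fun n ↦ ¬ n.Prime),
        Λ n / Real.sqrt n * Real.log (x / n) := by
  have hx0 : 0 < x := by linarith
  have hsx : 0 < Real.sqrt x := Real.sqrt_pos.2 hx0
  have hIcc : Finset.Icc 1 ⌊x * Real.exp 2⌋₊ = Finset.Ioc 0 ⌊x * Real.exp 2⌋₊ := by
    ext k; simp only [Finset.mem_Icc, Finset.mem_Ioc]; omega
  rw [hIcc, Chebyshev.psi_sub_theta_eq_sum_not_prime, Finset.mul_sum, Finset.sum_div,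
    ← Finset.sum_neg_distrib]
  refine Finset.sum_le_sum fun n hn ↦ ?_
  rw [Finset.mem_filter, Finset.mem_Ioc] at hn
  have hn0 : (0 : ℝ) < n := by exact_mod_cast hn.1.1
  have hnle : (n : ℝ) ≤ x * Real.exp 2 :=
    (Nat.cast_le.2 hn.1.2).trans (Nat.floor_le (by positivity))
  have hΛ : 0 ≤ Λ n := ArithmeticFunction.vonMangoldt_nonneg
  have hsn : 0 < Real.sqrt n := Real.sqrt_pos.2 hn0
  -- `log(x/n) ≥ −2`
  have hlog : -2 ≤ Real.log (x / n) := by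
    rw [Real.log_div hx0.ne' hn0.ne']
    have := Real.log_le_log hn0 hnle
    rw [Real.log_mul hx0.ne' (Real.exp_pos 2).ne', Real.log_exp] at this
    linarith
  rcases le_or_gt (n : ℝ) x with hnx | hnx
  · -- `n ≤ x`: the term is `≥ 0 ≥ −2Λ(n)/√x`
    have hlog0 : 0 ≤ Real.log (x / n) := Real.log_nonneg (by rw [le_div_iff₀ hn0]; linarith)
    have : 0 ≤ Λ n / Real.sqrt n * Real.log (x / n) := by positivity
    have : 0 ≤ 2 * Λ n / Real.sqrt x := by positivity
    linarith
  · -- `x < n`: `Λ/√n · log(x/n) ≥ −2Λ/√n ≥ −2Λ/√x`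
    have hsxn : Real.sqrt x ≤ Real.sqrt n := Real.sqrt_le_sqrt hnx.le
    have h1 : Λ n / Real.sqrt n * Real.log (x / n) ≥ Λ n / Real.sqrt n * (-2) :=
      mul_le_mul_of_nonneg_left hlog (div_nonneg hΛ hsn.le)
    have h2 : Λ n / Real.sqrt n ≤ Λ n / Real.sqrt x := div_le_div_of_nonneg_left hΛ hsx hsxn
    have h3 : 2 * Λ n / Real.sqrt x = 2 * (Λ n / Real.sqrt x) := by ring
    rw [h3]
    linarith

/-- The prime sum of Thm 5 is `√x` times the prime part of the cut-off sum:
`Σ_{p ≤ xe²} log p · √(x/p) log(x/p) = √x · Σ_{p ≤ xe²} Λ(p) p^{-1/2} log(x/p)`.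
[cite: Suzuki2025Chebyshev, §1.2 (1.20)] -/
theorem primeSum_eq_sqrt_mul {x : ℝ} (hx : 0 ≤ x) :
    ∑ p ∈ (Finset.Icc 1 ⌊x * Real.exp 2⌋₊).filter Nat.Prime,
        Real.log p * Real.sqrt (x / p) * Real.log (x / p) =
      Real.sqrt x * ∑ p ∈ (Finset.Icc 1 ⌊x * Real.exp 2⌋₊).filter Nat.Prime,
        Λ p / Real.sqrt p * Real.log (x / p) := by
  rw [Finset.mul_sum]
  refine Finset.sum_congr rfl fun p hp ↦ ?_
  rw [Finset.mem_filter] at hp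
  rw [ArithmeticFunction.vonMangoldt_apply_prime hp.2, Real.sqrt_div hx]
  ring

end ChebyshevHalfLineBiasThm2

open ChebyshevHalfLineBiasThm2 in
/-- **Suzuki 2025, Theorem 5 (second assertion)** — discharge of the named fact
`Suzuki2025Chebyshev_thm5_converse`: if RH holds and `Σ_ρ x^ρ/ρ = o(√x log x)` ((1.12), encoded with
`zetaZeroSumTrunc`), then `Σ_{p ≤ xe²} log p · √(x/p) log(x/p) → −∞` ((1.20)). Proof: by Thm 2 (⟸,
`Suzuki2025Chebyshev_thm2_iff_holds`) the cut-off sum over ALL prime powers is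
`F(x) log x = −(κ/2) log x + o(log x)` (`κ/2 = (ζ'/ζ)(1/2) > 0`); the non-prime prime powers contribute
`≥ −2(ψ(xe²) − ϑ(xe²))/√x ≥ −2Ce` (`sum_nonPrime_ge`, Mathlib `Chebyshev.psi_sub_theta_le_mul_sqrt`);
hence the prime sum is `≤ √x(−(κ/4) log x + 2Ce) → −∞`. RH-CONDITIONAL clause; RH-FREE proof.
[cite: Suzuki2025Chebyshev, §1.2 Thm 5 (second assertion); proof §4.3] -/
theorem Suzuki2025Chebyshev_thm5_converse_holds : Suzuki2025Chebyshev_thm5_converse := by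
  intro hRH h12
  set κ := Real.eulerMascheroniConstant + Real.pi / 2 + 3 * Real.log 2 + Real.log Real.pi with hκ
  have hκ0 : 0 < κ := screwKappa_pos
  have hF := tendsto_rieszCutoff_of_RH hRH h12
  obtain ⟨C, hC⟩ := Chebyshev.psi_sub_theta_le_mul_sqrt
  -- eventually `F(x) ≤ −κ/4`
  have hev : ∀ᶠ x : ℝ in atTop, ∑ n ∈ Finset.Icc 1 ⌊x * Real.exp 2⌋₊,
      Λ n / Real.sqrt n * (1 - Real.log n / Real.log x) ≤ -(κ / 4) := by
    have := (Metric.tendsto_nhds.1 hF) (κ / 4) (by positivity)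
    filter_upwards [this] with x hx
    rw [Real.dist_eq, abs_lt] at hx
    linarith [hx.2]
  -- comparison function `√x(−(κ/4) log x + 2Ce) → −∞`
  have hcmp : Tendsto (fun x : ℝ ↦ Real.sqrt x * (-(κ / 4) * Real.log x + 2 * C * Real.exp 1))
      atTop atBot := by
    have h1 : Tendsto (fun x : ℝ ↦ κ / 4 * Real.log x - 2 * C * Real.exp 1) atTop atTop :=
      tendsto_atTop_add_const_right _ _ (Real.tendsto_log_atTop.const_mul_atTop (by positivity))
    have h2 : Tendsto (fun x : ℝ ↦ Real.sqrt x * (κ / 4 * Real.log x - 2 * C * Real.exp 1))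
        atTop atTop :=
      (Real.tendsto_sqrt_atTop).atTop_mul_atTop₀ h1
    have h3 := tendsto_neg_atTop_atBot.comp h2
    refine h3.congr fun x ↦ ?_
    simp only [Function.comp]
    ring
  refine tendsto_atBot_mono' atTop ?_ hcmp
  filter_upwards [hev, eventually_gt_atTop (1 : ℝ)] with x hFx hx1
  have hx0 : 0 < x := by linarith
  have hL : 0 < Real.log x := Real.log_pos hx1
  have hsx : 0 < Real.sqrt x := Real.sqrt_pos.2 hx0
  rw [primeSum_eq_sqrt_mul hx0.le]
  refine mul_le_mul_of_nonneg_left ?_ hsx.le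
  -- split the cut-off sum into primes and non-primes
  have hsplit := Finset.sum_filter_add_sum_filter_not (Finset.Icc 1 ⌊x * Real.exp 2⌋₊) Nat.Prime
    (fun n ↦ Λ n / Real.sqrt n * Real.log (x / n))
  have hall : ∑ n ∈ Finset.Icc 1 ⌊x * Real.exp 2⌋₊, Λ n / Real.sqrt n * Real.log (x / n) ≤
      -(κ / 4) * Real.log x := by
    rw [← rieszCutoff_mul_log hx1]
    exact mul_le_mul_of_nonneg_right hFx hL.le
  have hnp := sum_nonPrime_ge hx1.le
  -- `ψ(xe²) − ϑ(xe²) ≤ C√(xe²) = C e √x`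
  have hpt : 2 * (ψ (x * Real.exp 2) - θ (x * Real.exp 2)) / Real.sqrt x ≤ 2 * C * Real.exp 1 := by
    rw [div_le_iff₀ hsx]
    have h1 := hC (x * Real.exp 2)
    have h2 : Real.sqrt (x * Real.exp 2) = Real.sqrt x * Real.exp 1 := by
      rw [Real.sqrt_mul hx0.le, show Real.exp 2 = Real.exp 1 * Real.exp 1 by
        rw [← Real.exp_add]; norm_num, Real.sqrt_mul_self (Real.exp_pos 1).le]
    rw [h2] at h1
    nlinarith [h1, hsx, Real.exp_pos 1]
  linarith

end Literature.NumberTheory.LFunctions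

end
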